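import Summits.SmoothPoincare4.SmoothPoincare4.Theses.SymplecticOrigami
import Summits.SmoothPoincare4.SmoothPoincare4.Theorems.SymplecticOrigamiOrigamiRungStubPinchAlexanderAux
import Literature.AlgebraicTopology.SingularHomology.UniversalCoefficientsField
import Literature.AlgebraicTopology.SingularHomology.CohomologyHomotopyInvariance
import Literature.AlgebraicTopology.SingularHomology.OrientationCover
import Literature.AlgebraicTopology.SingularHomology.SphereHomology
import Literature.AlgebraicTopology.SingularHomology.ExcisionMayerVietorisProofs
import Literature.AlgebraicTopology.SingularHomology.MayerVietorisExactness
import Literature.Topology.FourManifolds.SphereSimplyConnected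

/-!
# Stub `stub_pinch_alexander` of line `pair-rigidity-endgame` (crux `SymplecticOrigami.OrigamiRung`)

**Alexander duality across the fold, with field coefficients.**  `M` is a compact boundaryless
smooth `4`-manifold homotopy equivalent to `S⁴`, `τ : M → ℝ` is smooth with `0` a regular level,
and both sides `V₀ = {τ < 0}`, `V₁ = {τ > 0}` are connected.  For every field `F` (with the
homology of the sides finite-dimensional):
`h₁({τ = 0}) = h₁(V₀) + h₁(V₁)` (the PINCH), `h₁(V₀) = h₂(V₁)`, `h₁(V₁) = h₂(V₀)`,
`h₃(V₀) = h₃(V₁) = 0` (Hatcher 2002, Thm. 3.44 / Bredon 1993, VI.8, in the homology sphere `M`).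

Proof, over the tree's PROVED singular-homology library:

* `M ≃ S⁴` is simply connected (`simplyConnectedSpace_of_homotopyEquiv_sphere_four`), hence
  `F`-oriented (`isOrientableOver_of_simplyConnectedSpace`, Hatcher Prop. 3.25), and
  `H₁ = H₂ = H₃ = 0`, `H₄ ≅ F` (`isZero_singularHomology_sphere_holds`,
  `singularHomologyUnitSphereIso`).
* `PinchHomology.side` — for the compact set `W = {τ ≥ 0}` with complement `V₀`:
  `H_q(M, V₀) = H_q(M | W) ≅ Ȟᵖ(W) ≅ Hᵖ(↥W) ≅ Hᵖ(V₁)` and `dim Hᵖ(V₁; F) = h_p(V₁)`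
  (Čech duality `CechDuality.classAlong_of_isCompact`, the tautness datum and the push
  `W ≃ V₁` of the collar flow of the regular level — part 1,
  `SymplecticOrigamiOrigamiRungStubPinchAlexanderAux.lean` —, homotopy invariance of singular
  cohomology, universal coefficients `finrank_singularCohomology_eq_bettiNumber_of_field`); the
  exact sequence of the pair `(M, V₀)` then gives `h₁(V₀) = h₂(V₁)`, `h₂(V₀) = h₁(V₁)`, and
  `h₃(V₀) = 0` from `H₄(V₀) = 0` (non-compact side) and `dim H₄(M) = dim H₄(M, V₀) = 1`.
  Applied to `τ` and to `-τ`.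
* `PinchHomology.pinch` — Mayer–Vietoris for `M = {τ < ε} ∪ {τ > -ε}` (`mayerVietoris.exact₁/₃`)
  with `H₁(M) = H₂(M) = 0`: `H₁(band) ≅ H₁({τ<ε}) ⊕ H₁({τ>-ε})`, and the band, resp. the two
  pieces, are homotopy equivalent to the level, resp. the two sides, along the collar flows of
  `τ` and `-τ`.

Everything is proved; all folklore.
-/

noncomputable section

-- the prescribed namespace `Summit.<P>.<Sub>.…` duplicates `SmoothPoincare4` (P = Sub)
set_option linter.dupNamespace false

open scoped Manifold ContDiff Topology ContinuousMap
open Set TopologicalSpace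

namespace Summit.SmoothPoincare4.SmoothPoincare4.Theorems.OrigamiRung.PairRigidityEndgame

open CategoryTheory CategoryTheory.Limits
open Literature.Topology.FourManifolds Literature.AlgebraicTopology.SingularHomology

/-- Model space `ℝⁿ`. -/
local notation "𝔼" n:arg => EuclideanSpace ℝ (Fin n)
/-- The round 4-sphere. -/
local notation "𝕊⁴" => (Metric.sphere (0 : EuclideanSpace ℝ (Fin 5)) 1)

namespace PinchHomology

variable (F : Type) [Field F] {M : Type} [TopologicalSpace M] [T2Space M] [CompactSpace M]
  [ChartedSpace (𝔼 4) M] [IsManifold (𝓡 4) ∞ M]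

/-- **Alexander duality across a regular level, one side** (Hatcher Thm. 3.44 in the homology
`4`-sphere `M`, for the compact set `W = {τ ≥ 0}`): `h₁({τ<0}) = h₂({τ>0})`,
`h₂({τ<0}) = h₁({τ>0})` and `h₃({τ<0}) = 0` over the field `F`.  The exact sequence of the pair
`(M, {τ < 0})` with `H₁ = H₂ = H₃ = 0`, `dim H₄(M) = 1`, `H₄({τ<0}) = 0` (non-compact side) gives
`H_k({τ<0}) ≅ H_{k+1}(M, {τ<0})` (`k = 1, 2`) and `H₃({τ<0}) = 0` once `dim H₄(M, {τ<0}) = 1`;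
and `H_q(M, {τ<0}) = H_q(M | W) ≅ Ȟᵖ(W) ≅ Hᵖ(↥W) ≅ Hᵖ({τ>0})`, `dim = h_p({τ>0})`, by Čech
duality, the tautness datum of the collar flow, the push `W ≃ {τ>0}` and universal coefficients.
[folklore] -/
theorem side [ConnectedSpace M] (μ : HomologicalOrientation F M 4)
    (h₁ : IsZero (singularHomology F F M 1)) (h₂ : IsZero (singularHomology F F M 2))
    (h₃ : IsZero (singularHomology F F M 3)) (h₄ : Module.finrank F (singularHomology F F M 4) = 1)
    {τ : M → ℝ} (U : LevelUnitField 3 τ 0)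
    (hc₀ : IsConnected {x : M | τ x < 0}) (hc₁ : IsConnected {x : M | 0 < τ x}) :
    Module.finrank F (singularHomology F F ↥{x : M | τ x < 0} 1) =
        Module.finrank F (singularHomology F F ↥{x : M | 0 < τ x} 2) ∧
      Module.finrank F (singularHomology F F ↥{x : M | τ x < 0} 2) =
        Module.finrank F (singularHomology F F ↥{x : M | 0 < τ x} 1) ∧
      Module.finrank F (singularHomology F F ↥{x : M | τ x < 0} 3) = 0 := by
  have hτ : Continuous τ := U.contMDiff_f.continuous
  -- the compact side `W = {τ ≥ 0}` and its complement
  have hW : IsCompact {x : M | 0 ≤ τ x} := (isClosed_le continuous_const hτ).isCompact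
  have hWc : {x : M | 0 ≤ τ x}ᶜ = {x | τ x < 0} := by ext; simp [not_le]
  -- Čech duality along `W`, tautness, `W ≃ {τ > 0}`, universal coefficients
  obtain ⟨e⟩ := PinchFlow.nonempty_posHomotopyEquiv U (T := {x | 0 ≤ τ x})
    (fun x (hx : 0 ≤ τ x) => show -U.δ < τ x by linarith [U.δ_pos])
    (fun x (hx : 0 ≤ τ x) y hxy => le_trans hx hxy) (fun x (hx : 0 < τ x) => hx.le)
  obtain ⟨T⟩ := PinchFlow.nonempty_retractionNhds U
  have hdual : ∀ {p q : ℕ}, p + q = 4 →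
      Module.finrank F (relativeSingularHomology F F M {x : M | 0 ≤ τ x}ᶜ q) =
        Module.finrank F (singularHomology F F ↥{x : M | 0 < τ x} p) := by
    intro p q h
    rw [PinchHomology.finrank_relativeSingularHomology_compl F μ hW T h,
      (singularCohomology.isoOfHomotopyEquiv' F F e p).toLinearEquiv.finrank_eq,
      finrank_singularCohomology_eq_bettiNumber_of_field]
    rfl
  -- the exact sequence of the pair `(M, {τ < 0})`
  have e₁ := LinearEquiv.ofBijective _ (PinchHomology.bijective_δ F {x : M | 0 ≤ τ x}ᶜ 0 h₁ h₂)
  have e₂ := LinearEquiv.ofBijective _ (PinchHomology.bijective_δ F {x : M | 0 ≤ τ x}ᶜ 1 h₂ h₃)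
  have hV₀ : IsZero (singularHomology F F ↥({x : M | 0 ≤ τ x}ᶜ) 4) := by
    rw [hWc]
    refine PinchHomology.isZero_singularHomology_four_of_isOpen F (isOpen_lt hτ continuous_const)
      hc₀ fun h => ?_
    obtain ⟨x, hx⟩ := hc₁.nonempty
    have hx' : x ∈ {x : M | τ x < 0} := h ▸ mem_univ x
    have h0 : 0 < τ x := hx
    have h0' : τ x < 0 := hx'
    exact lt_asymm h0 h0'
  have hz₃ := PinchHomology.isZero_of_top F {x : M | 0 ≤ τ x}ᶜ 3 hV₀ h₃ h₄
    ((hdual (p := 0) (q := 4) rfl).trans (PinchHomology.finrank_singularHomology_zero_of_isOpen F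
      (isOpen_lt continuous_const hτ) hc₁))
  have r₁ : Module.finrank F (singularHomology F F ↥({x : M | 0 ≤ τ x}ᶜ) 1) =
      Module.finrank F (singularHomology F F ↥{x : M | 0 < τ x} 2) :=
    e₁.finrank_eq.symm.trans (hdual (p := 2) (q := 2) rfl)
  have r₂ : Module.finrank F (singularHomology F F ↥({x : M | 0 ≤ τ x}ᶜ) 2) =
      Module.finrank F (singularHomology F F ↥{x : M | 0 < τ x} 1) :=
    e₂.finrank_eq.symm.trans (hdual (p := 1) (q := 3) rfl)
  have r₃ : Module.finrank F (singularHomology F F ↥({x : M | 0 ≤ τ x}ᶜ) 3) = 0 := by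
    haveI := ModuleCat.subsingleton_of_isZero hz₃
    exact Module.finrank_zero_of_subsingleton
  rw [hWc] at r₁ r₂ r₃
  exact ⟨r₁, r₂, r₃⟩

/-- **The pinch `h₁({τ = 0}) = h₁({τ < 0}) + h₁({τ > 0})`** (Mayer–Vietoris for the open cover
`M = {τ < ε} ∪ {τ > -ε}` with `H₁(M) = H₂(M) = 0`: `H₁` of the thin band is `H₁({τ<ε}) ⊕
H₁({τ>-ε})`; the band retracts onto the level and the two pieces are pushed onto the two sides by
the collar flows of `τ` and `-τ`). [folklore] -/
theorem pinch (h₁ : IsZero (singularHomology F F M 1)) (h₂ : IsZero (singularHomology F F M 2))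
    {τ : M → ℝ} (U : LevelUnitField 3 τ 0) (U' : LevelUnitField 3 (-τ) 0)
    (hf₀ : Module.Finite F (singularHomology F F ↥{x : M | τ x < 0} 1))
    (hf₁ : Module.Finite F (singularHomology F F ↥{x : M | 0 < τ x} 1)) :
    Module.finrank F (singularHomology F F ↥{x : M | τ x = 0} 1) =
      Module.finrank F (singularHomology F F ↥{x : M | τ x < 0} 1) +
        Module.finrank F (singularHomology F F ↥{x : M | 0 < τ x} 1) := by
  have hτ : Continuous τ := U.contMDiff_f.continuous
  -- a common half-width of the two collars
  obtain ⟨ε, hε, hεU, hεU'⟩ : ∃ ε, 0 < ε ∧ ε < U.δ ∧ ε < U'.δ :=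
    ⟨min U.δ U'.δ / 2, by positivity [lt_min U.δ_pos U'.δ_pos], by
      linarith [min_le_left U.δ U'.δ, lt_min U.δ_pos U'.δ_pos], by
      linarith [min_le_right U.δ U'.δ, lt_min U.δ_pos U'.δ_pos]⟩
  -- the open cover `{τ < ε} ∪ {τ > -ε}`
  have hAB : interior {x : M | τ x < ε} ∪ interior {x : M | -ε < τ x} = univ := by
    rw [(isOpen_lt hτ continuous_const).interior_eq, (isOpen_lt continuous_const hτ).interior_eq]
    refine eq_univ_of_forall fun x => ?_
    by_cases h : τ x < ε
    · exact Or.inl h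
    · exact Or.inr (show -ε < τ x by linarith [not_lt.mp h])
  -- the three homotopy equivalences
  obtain ⟨eB⟩ : Nonempty (↥{x : M | 0 < τ x} ≃ₕ ↥{x : M | -ε < τ x}) :=
    PinchFlow.nonempty_posHomotopyEquiv U (fun x (hx : -ε < τ x) => show -U.δ < τ x by linarith)
      (fun x (hx : -ε < τ x) y hxy => lt_of_lt_of_le hx hxy) (fun x (hx : 0 < τ x) => by
        show -ε < τ x; linarith)
  have hA₀ : {x : M | τ x < 0} = {x | 0 < (-τ) x} := by ext; simp
  have hAε : {x : M | -ε < (-τ) x} = {x | τ x < ε} := by ext; simp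
  obtain ⟨eA'⟩ := PinchFlow.nonempty_posHomotopyEquiv U' (T := {x : M | -ε < (-τ) x})
    (fun x (hx : -ε < (-τ) x) => show -U'.δ < (-τ) x by linarith)
    (fun x (hx : -ε < (-τ) x) y hxy => lt_of_lt_of_le hx hxy)
    (fun x (hx : 0 < (-τ) x) => by show -ε < (-τ) x; linarith)
  have eA : ↥{x : M | τ x < 0} ≃ₕ ↥{x : M | τ x < ε} :=
    ((Homeomorph.setCongr hA₀).toHomotopyEquiv.trans eA').trans
      (Homeomorph.setCongr hAε).toHomotopyEquiv
  obtain ⟨eZ⟩ : Nonempty (↥{x : M | τ x = 0} ≃ₕ ↥({x : M | τ x < ε} ∩ {x | -ε < τ x})) :=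
    PinchFlow.nonempty_levelHomotopyEquiv U hε hεU.le
  -- Mayer–Vietoris: `φ : H₁(band) → H₁({τ<ε}) ⊞ H₁({τ>-ε})` is bijective
  have hexc := relativeSingularHomology.isIso_map_of_interior_union_interior_holds F F M
  have hm : Mono (mayerVietoris.φ F F {x : M | τ x < ε} {x : M | -ε < τ x} 1) :=
    (mayerVietoris.exact₃_holds F F {x : M | τ x < ε} {x : M | -ε < τ x} hexc hAB 1).mono_g
      (h₂.eq_of_src _ _)
  have he : Epi (mayerVietoris.φ F F {x : M | τ x < ε} {x : M | -ε < τ x} 1) :=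
    (mayerVietoris.exact₁_holds F F {x : M | τ x < ε} {x : M | -ε < τ x} hAB 1).epi_f
      (h₁.eq_of_tgt _ _)
  have eφ := LinearEquiv.ofBijective _
    ⟨(ModuleCat.mono_iff_injective _).mp hm, (ModuleCat.epi_iff_surjective _).mp he⟩
  -- finiteness of the two pieces, then count dimensions
  haveI : Module.Finite F (singularHomology F F ↥{x : M | τ x < ε} 1) :=
    Module.Finite.equiv (singularHomology.isoOfHomotopyEquiv F F eA 1).toLinearEquiv
  haveI : Module.Finite F (singularHomology F F ↥{x : M | -ε < τ x} 1) :=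
    Module.Finite.equiv (singularHomology.isoOfHomotopyEquiv F F eB 1).toLinearEquiv
  rw [(singularHomology.isoOfHomotopyEquiv F F eZ 1).toLinearEquiv.finrank_eq, eφ.finrank_eq,
    (ModuleCat.biprodIsoProd _ _).toLinearEquiv.finrank_eq,
    (singularHomology.isoOfHomotopyEquiv F F eA 1).toLinearEquiv.finrank_eq,
    (singularHomology.isoOfHomotopyEquiv F F eB 1).toLinearEquiv.finrank_eq]
  exact Module.finrank_prod

end PinchHomology

open PinchHomology in
/-- **Stub P1 — Alexander duality across the fold, with field coefficients** (Hatcher Thm. 3.44 /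
Bredon VI.8 in the homotopy `4`-sphere `M`, split along the compact regular level `{τ = 0}`):
`h₁({τ=0}) = h₁({τ<0}) + h₁({τ>0})` (the pinch), `h₁({τ<0}) = h₂({τ>0})`,
`h₁({τ>0}) = h₂({τ<0})`, `h₃({τ<0}) = h₃({τ>0}) = 0`.  `M ≃ S⁴` is simply connected, hence
`F`-oriented, with `H₁ = H₂ = H₃ = 0`, `H₄ ≅ F`; the side relations are `PinchHomology.side` for
`τ` and for `-τ` (Čech duality along `{τ ≥ 0}`, tautness and the push from the collar flow of the
regular level, the exact sequence of the pair, the non-compact side, universal coefficients), the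
pinch is `PinchHomology.pinch` (Mayer–Vietoris). [folklore] -/
theorem stub_pinch_alexander :
    ∀ (M : Type) [TopologicalSpace M] [T2Space M] [SecondCountableTopology M] [CompactSpace M]
      [ChartedSpace (𝔼 4) M] [IsManifold (𝓡 4) ∞ M],
      M ≃ₕ 𝕊⁴ →
      ∀ (τ : M → ℝ), ContMDiff (𝓡 4) 𝓘(ℝ, ℝ) ∞ τ →
      (∀ x, τ x = 0 → mfderiv (𝓡 4) 𝓘(ℝ, ℝ) τ x ≠ 0) →
      IsConnected {x : M | τ x < 0} → IsConnected {x : M | 0 < τ x} →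
      ∀ (F : Type) [Field F],
        (∀ k, Module.Finite F (singularHomology F F ↥{x : M | τ x < 0} k)) →
        (∀ k, Module.Finite F (singularHomology F F ↥{x : M | 0 < τ x} k)) →
        Module.finrank F (singularHomology F F ↥{x : M | τ x = 0} 1) =
            Module.finrank F (singularHomology F F ↥{x : M | τ x < 0} 1) +
              Module.finrank F (singularHomology F F ↥{x : M | 0 < τ x} 1) ∧
          Module.finrank F (singularHomology F F ↥{x : M | τ x < 0} 1) =
            Module.finrank F (singularHomology F F ↥{x : M | 0 < τ x} 2) ∧
          Module.finrank F (singularHomology F F ↥{x : M | 0 < τ x} 1) =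
            Module.finrank F (singularHomology F F ↥{x : M | τ x < 0} 2) ∧
          Module.finrank F (singularHomology F F ↥{x : M | τ x < 0} 3) = 0 ∧
          Module.finrank F (singularHomology F F ↥{x : M | 0 < τ x} 3) = 0 := by
  intro M _ _ _ _ _ _ e τ hτ hreg hc₀ hc₁ F _ hf₀ hf₁
  -- the homotopy 4-sphere: simply connected, hence `F`-oriented; homology of `S⁴`
  haveI : SimplyConnectedSpace M :=
    simplyConnectedSpace_of_homotopyEquiv_sphere_four simplyConnectedSpace_sphere_four_holds M e
  obtain ⟨μ⟩ : Nonempty (HomologicalOrientation F M 4) := isOrientableOver_of_simplyConnectedSpace F M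
  have hS : ∀ k, k ≠ 0 → k ≠ 4 → IsZero (singularHomology F F M k) := fun k hk hk4 =>
    (isZero_singularHomology_sphere_holds F F hk hk4).of_iso (singularHomology.isoOfHomotopyEquiv F F e k)
  have h₄ : Module.finrank F (singularHomology F F M 4) = 1 := by
    rw [((singularHomology.isoOfHomotopyEquiv F F e 4).trans
      (singularHomologyUnitSphereIso F F 4 (by norm_num))).toLinearEquiv.finrank_eq]
    exact Module.finrank_self F
  -- unit-speed collar fields for `τ` and `-τ`
  have hlev : IsRegularLevel (𝓡 4) τ 0 :=
    ⟨hτ, fun x _ => BoundarylessManifold.isInteriorPoint' x, fun x hx => hreg x hx⟩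
  have hlev' : IsRegularLevel (𝓡 4) (-τ) 0 := by
    refine ⟨hτ.neg, fun x _ => BoundarylessManifold.isInteriorPoint' x, fun x hx h => ?_⟩
    refine hreg x (by simpa using hx) ?_
    have h' : mfderiv (𝓡 4) 𝓘(ℝ, ℝ) (-τ) x = 0 := h
    have key := (mfderiv_neg : mfderiv (𝓡 4) 𝓘(ℝ, ℝ) (-τ) x = -mfderiv (𝓡 4) 𝓘(ℝ, ℝ) τ x).symm.trans h'
    exact neg_eq_zero.mp key
  obtain ⟨U⟩ := hlev.exists_levelUnitField
  obtain ⟨U'⟩ := hlev'.exists_levelUnitField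
  have hA : {x : M | (-τ) x < 0} = {x | 0 < τ x} := by ext; simp
  have hB : {x : M | 0 < (-τ) x} = {x | τ x < 0} := by ext; simp
  obtain ⟨r₁, r₂, r₃⟩ := side F μ (hS 1 one_ne_zero (by norm_num)) (hS 2 two_ne_zero (by norm_num))
    (hS 3 three_ne_zero (by norm_num)) h₄ U hc₀ hc₁
  obtain ⟨-, -, r₃'⟩ := side F μ (hS 1 one_ne_zero (by norm_num)) (hS 2 two_ne_zero (by norm_num))
    (hS 3 three_ne_zero (by norm_num)) h₄ U' (by rwa [hA]) (by rwa [hB])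
  rw [hA] at r₃'
  exact ⟨pinch F (hS 1 one_ne_zero (by norm_num)) (hS 2 two_ne_zero (by norm_num)) U U' (hf₀ 1)
    (hf₁ 1), r₁, r₂.symm, r₃, r₃'⟩

end Summit.SmoothPoincare4.SmoothPoincare4.Theorems.OrigamiRung.PairRigidityEndgame

end
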